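import Mathlib
import HarnessLib
import Summits.HubbardSuperconductivity.HubbardSuperconductivity.Theorems.KLProgrammeSalmhoferCutoffDerivTableRecord
import Summits.HubbardSuperconductivity.HubbardSuperconductivity.Theorems.KLProgrammeCutCurrencyLegMass

/-!
# Route `KLProgramme` — ENGINE (stmt-HubbardSuperconductivity-20437 `KLRegimeEngineV17F2`), located #25 «(b)-PLAIN-UV-TAIL», cure (α),
# E1 item (i), appendix for the WEIGHTED rows: the reflection identity `ĝ(|y|) = ψ(y) + ψ(−y) − 1`, third-order cyclic summation by parts,
# the third-difference bound `|Δ³ψ| ≤ 2K₃δ³`, and the POINTWISE DECAY of the leg transform `|ĉ(j)|·(4·dist(j)/2M)^k ≤ C_k(β)` (`k = 2, 3`)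
# (cell gate-hubbard-kl, seat hubbard-kl-k3c2-p2 g35)

Binder #6's literal `a·|U|` term is the `klScaleWt_n`-WEIGHTED (`1 + Λ_n·diam`) cut plain currency; the weight costs one time moment of the cut kernel, i.e. one
more order of decay of the leg transform than summability.  This file supplies the model-free inputs:
* `klct_absProfile_eq_sum` — `σ(4/3 − 32|y|/3) = ψ(y) + ψ(−y) − 1` for ALL `y` (`ψ(r) = σ(4/3 − 32r/3)`): every finite difference of the cut profile is the sum
  of the one-sided one and its reflection — no case analysis;
* `klct_secondDiff_le_of_lipschitz_deriv` — generic: `f′` `L`-Lipschitz ⇒ `|f(x+δ) − 2f(x) + f(x−δ)| ≤ 2Lδ²`;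
* `klct_abs_deriv3_profile_le` (`|ψ‴| ≤ K₃ := (32/3)³·5391`, the tree's proved Cauchy row `smoothTransitionCauchyTab 3`), `klct_deriv2_profile_lipschitz`,
  **`klct_profile_thirdDiff_le`** `|ψ(x+3δ) − 3ψ(x+2δ) + 3ψ(x+δ) − ψ(x)| ≤ 2K₃δ³`, **`klct_absProfile_thirdDiff_le`** (`≤ 4K₃δ³` for the cut profile);
* `klct_cyclic_sbp_three`, **`klct_normCube_mul_norm_sum_le_thirdDiff`** — `|z−1|³|Σ_v f(v)z^v| ≤ Σ_v|f(v−3) − 3f(v−2) + 3f(v−1) − f(v)|` on `ℤ_N`;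
* **`klct_legTransform_uvCut_sq_decay`** — `|ĉ(j)|·(4·min(j, 2M−j)/2M)² ≤ C₂(β) = 2K(2π/β)²(3β/(32π)+6)` for every `j` (`128 ≤ β ≤ M`): the pointwise form of
  `…LegMass` §4–§5, i.e. `|ĉ(j)| ≲ C₂M²/(4·dist²)`.
No definition; nothing asserts any row, (b), (C), K3, U₀, the window or superconductivity.
References: BGM 2006 §2.2–2.3 [cite: BenfattoGiulianiMastropietro2006]; Zygmund, Trigonometric Series I §II.2 [folklore].
-/

noncomputable section

namespace Summit.HubbardSuperconductivity.HubbardSuperconductivity.Theorems.KLRegimeSplit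

set_option linter.dupNamespace false -- summit = problem name (single-conjunct summit), D-0017

open Finset Literature.MathematicalPhysics.QuantumLattice

/-! ## §1 The reflection identity -/

/-- **`ĝ(|y|) = ψ(y) + ψ(−y) − 1` for every `y`** (one of `±y` is `≤ 0 ≤ 1/32`, where `ψ = 1`). -/
theorem klct_absProfile_eq_sum (y : ℝ) :
    Real.smoothTransition (4 / 3 - 32 / 3 * |y|) = Real.smoothTransition (4 / 3 - 32 / 3 * y) + Real.smoothTransition (4 / 3 - 32 / 3 * (-y)) - 1 := by
  rcases le_or_gt 0 y with h | h
  · rw [abs_of_nonneg h, klct_profile_eq_one (show -y ≤ 1 / 32 by linarith)]; ring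
  · rw [abs_of_neg h, klct_profile_eq_one (show y ≤ 1 / 32 by linarith)]; ring

/-! ## §2 A generic second-difference lemma -/

/-- **Generic three-point bound**: if `f` is differentiable on `ℝ` and `deriv f` is `L`-Lipschitz, then `|f(x+δ) − 2f(x) + f(x−δ)| ≤ 2Lδ²` (`0 < δ`). -/
theorem klct_secondDiff_le_of_lipschitz_deriv {f : ℝ → ℝ} (hf : Differentiable ℝ f) {L : ℝ}
    (hL : ∀ a b : ℝ, |deriv f a - deriv f b| ≤ L * |a - b|) (x : ℝ) {δ : ℝ} (hδ : 0 < δ) :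
    |f (x + δ) - 2 * f x + f (x - δ)| ≤ 2 * L * δ ^ 2 := by
  obtain ⟨ξ₁, hξ₁, h₁⟩ := exists_deriv_eq_slope f (by linarith : x < x + δ) hf.continuous.continuousOn (hf.differentiableOn)
  obtain ⟨ξ₂, hξ₂, h₂⟩ := exists_deriv_eq_slope f (by linarith : x - δ < x) hf.continuous.continuousOn (hf.differentiableOn)
  have e₁ : f (x + δ) - f x = δ * deriv f ξ₁ := by rw [h₁, add_sub_cancel_left, mul_div_cancel₀ _ hδ.ne']
  have e₂ : f x - f (x - δ) = δ * deriv f ξ₂ := by rw [h₂, sub_sub_cancel, mul_div_cancel₀ _ hδ.ne']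
  have hkey : f (x + δ) - 2 * f x + f (x - δ) = δ * (deriv f ξ₁ - deriv f ξ₂) := by linear_combination e₁ - e₂
  rw [hkey, abs_mul, abs_of_pos hδ]
  have hLip := hL ξ₁ ξ₂
  have hdist : |ξ₁ - ξ₂| ≤ 2 * δ := by
    rw [abs_le]; constructor <;> linarith [hξ₁.1, hξ₁.2, hξ₂.1, hξ₂.2]
  have hL0 : 0 ≤ L := by
    by_contra hneg; push Not at hneg
    have h1 : |deriv f ξ₁ - deriv f ξ₂| < 0 ∨ |ξ₁ - ξ₂| = 0 := by
      rcases eq_or_ne (|ξ₁ - ξ₂|) 0 with h0 | h0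
      · right; exact h0
      · left; exact hLip.trans_lt (mul_neg_of_neg_of_pos hneg (lt_of_le_of_ne (abs_nonneg _) (Ne.symm h0)))
    rcases h1 with h1 | h1
    · exact absurd h1 (not_lt.mpr (abs_nonneg _))
    · rw [h1, mul_zero] at hLip
      have : ξ₁ = ξ₂ := by rw [abs_eq_zero, sub_eq_zero] at h1; exact h1
      linarith [hξ₁.1, hξ₂.2]
  calc δ * |deriv f ξ₁ - deriv f ξ₂| ≤ δ * (L * (2 * δ)) := by
        apply mul_le_mul_of_nonneg_left _ hδ.le
        exact hLip.trans (by gcongr)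
    _ = 2 * L * δ ^ 2 := by ring

/-! ## §3 The third derivative of the profile and the Lipschitz bound on `ψ″` -/

/-- `σ″` is differentiable (third application of `contDiff_infty_iff_deriv`). -/
theorem klct_smoothTransition_differentiable_deriv2 : Differentiable ℝ (deriv (deriv Real.smoothTransition)) := by
  have h := contDiff_infty_iff_deriv.mp (Real.smoothTransition.contDiff (n := ⊤))
  have h2 := contDiff_infty_iff_deriv.mp h.2
  exact (contDiff_infty_iff_deriv.mp h2.2).1

/-- `|σ‴| ≤ 5391` (the tree's proved Cauchy row `smoothTransitionCauchyTab 3`). -/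
theorem klct_abs_deriv3_smoothTransition_le (x : ℝ) : |deriv (deriv (deriv Real.smoothTransition)) x| ≤ 5391 := by
  have h := abs_iteratedDeriv_smoothTransition_le_cauchyTab 3 x
  rw [iteratedDeriv_succ, iteratedDeriv_succ, iteratedDeriv_one] at h
  refine h.trans (le_of_eq ?_)
  norm_num [smoothTransitionCauchyTab]

/-- `ψ‴(r) = −(32/3)³·σ‴(4/3 − 32r/3)` (as a `HasDerivAt` of `ψ″`). -/
theorem klct_deriv2_profile_hasDerivAt (r : ℝ) :
    HasDerivAt (deriv (deriv (fun r : ℝ => Real.smoothTransition (4 / 3 - 32 / 3 * r))))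
      (deriv (deriv (deriv Real.smoothTransition)) (4 / 3 - 32 / 3 * r) * (-(32 / 3)) * (-(32 / 3)) * (-(32 / 3))) r := by
  have hfun : deriv (deriv (fun r : ℝ => Real.smoothTransition (4 / 3 - 32 / 3 * r))) =
      fun r => deriv (deriv Real.smoothTransition) (4 / 3 - 32 / 3 * r) * (-(32 / 3)) * (-(32 / 3)) :=
    funext (fun r => (klct_deriv_profile_hasDerivAt r).deriv)
  rw [hfun]
  exact (((klct_smoothTransition_differentiable_deriv2 _).hasDerivAt.comp r (klct_affine_hasDerivAt r)).mul_const _).mul_const _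

/-- **`|ψ‴| ≤ K₃ = (32/3)³·5391`**. -/
theorem klct_abs_deriv3_profile_le (r : ℝ) :
    |deriv (deriv (deriv (fun r : ℝ => Real.smoothTransition (4 / 3 - 32 / 3 * r)))) r| ≤ (32 / 3) ^ 3 * 5391 := by
  rw [(klct_deriv2_profile_hasDerivAt r).deriv, abs_mul, abs_mul, abs_mul]
  have h := klct_abs_deriv3_smoothTransition_le (4 / 3 - 32 / 3 * r)
  have h32 : |(-(32 / 3) : ℝ)| = 32 / 3 := by norm_num [abs_of_pos]
  rw [h32]
  nlinarith [abs_nonneg (deriv (deriv (deriv Real.smoothTransition)) (4 / 3 - 32 / 3 * r))]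

/-- **`ψ″` is `K₃`-Lipschitz.** -/
theorem klct_deriv2_profile_lipschitz (r₁ r₂ : ℝ) :
    |deriv (deriv (fun r : ℝ => Real.smoothTransition (4 / 3 - 32 / 3 * r))) r₁ - deriv (deriv (fun r : ℝ => Real.smoothTransition (4 / 3 - 32 / 3 * r))) r₂| ≤
      (32 / 3) ^ 3 * 5391 * |r₁ - r₂| := by
  have h := Convex.norm_image_sub_le_of_norm_deriv_le (f := deriv (deriv (fun r : ℝ => Real.smoothTransition (4 / 3 - 32 / 3 * r)))) (s := Set.univ)
    (fun x _ => (klct_deriv2_profile_hasDerivAt x).differentiableAt)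
    (fun x _ => by rw [Real.norm_eq_abs]; exact klct_abs_deriv3_profile_le x) convex_univ (Set.mem_univ r₂) (Set.mem_univ r₁)
  simpa only [Real.norm_eq_abs] using h

/-! ## §4 The third difference of the profile -/

/-- **`|ψ(x+3δ) − 3ψ(x+2δ) + 3ψ(x+δ) − ψ(x)| ≤ 2K₃δ³`** (`0 < δ`): the second difference of `Φ(x) = ψ(x+δ) − ψ(x)`, whose derivative
`ψ′(x+δ) − ψ′(x)` is `K₃δ`-Lipschitz. -/
theorem klct_profile_thirdDiff_le (x : ℝ) {δ : ℝ} (hδ : 0 < δ) :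
    |Real.smoothTransition (4 / 3 - 32 / 3 * (x + 3 * δ)) - 3 * Real.smoothTransition (4 / 3 - 32 / 3 * (x + 2 * δ)) +
        3 * Real.smoothTransition (4 / 3 - 32 / 3 * (x + δ)) - Real.smoothTransition (4 / 3 - 32 / 3 * x)| ≤ 2 * ((32 / 3) ^ 3 * 5391) * δ ^ 3 := by
  set P : ℝ → ℝ := fun r => Real.smoothTransition (4 / 3 - 32 / 3 * r) with hP
  have hPd : Differentiable ℝ P := klct_profile_differentiable
  -- `Φ(x) = P(x+δ) − P(x)`
  set Φ : ℝ → ℝ := fun r => P (r + δ) - P r with hΦ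
  have hshift : ∀ r, HasDerivAt (fun r => P (r + δ)) (deriv P (r + δ)) r := fun r =>
    HasDerivAt.comp_add_const r δ (hPd (r + δ)).hasDerivAt
  have hΦd : ∀ r, HasDerivAt Φ (deriv P (r + δ) - deriv P r) r := fun r => (hshift r).sub (hPd r).hasDerivAt
  have hΦdiff : Differentiable ℝ Φ := fun r => (hΦd r).differentiableAt
  have hΦ' : ∀ r, deriv Φ r = deriv P (r + δ) - deriv P r := fun r => (hΦd r).deriv
  -- `Φ′` is `K₃δ`-Lipschitz
  have hP'd : ∀ r, HasDerivAt (deriv P) (deriv (deriv P) r) r := fun r => (klct_deriv_profile_hasDerivAt r).differentiableAt.hasDerivAt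
  have hΦ'd : ∀ r, HasDerivAt (deriv Φ) (deriv (deriv P) (r + δ) - deriv (deriv P) r) r := by
    intro r
    have hfun : deriv Φ = fun r => deriv P (r + δ) - deriv P r := funext hΦ'
    rw [hfun]
    have h1 : HasDerivAt (fun r => deriv P (r + δ)) (deriv (deriv P) (r + δ)) r := HasDerivAt.comp_add_const r δ (hP'd (r + δ))
    exact h1.sub (hP'd r)
  have hLip : ∀ a b : ℝ, |deriv Φ a - deriv Φ b| ≤ ((32 / 3) ^ 3 * 5391 * δ) * |a - b| := by
    intro a b
    have h := Convex.norm_image_sub_le_of_norm_deriv_le (f := deriv Φ) (s := Set.univ) (C := (32 / 3) ^ 3 * 5391 * δ)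
      (fun x _ => (hΦ'd x).differentiableAt)
      (fun x _ => by
        rw [(hΦ'd x).deriv, Real.norm_eq_abs]
        have := klct_deriv2_profile_lipschitz (x + δ) x
        rwa [add_sub_cancel_left, abs_of_pos hδ] at this) convex_univ (Set.mem_univ b) (Set.mem_univ a)
    simpa only [Real.norm_eq_abs] using h
  have h := klct_secondDiff_le_of_lipschitz_deriv hΦdiff hLip (x + δ) hδ
  have hre : Φ (x + δ + δ) - 2 * Φ (x + δ) + Φ (x + δ - δ) = P (x + 3 * δ) - 3 * P (x + 2 * δ) + 3 * P (x + δ) - P x := by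
    simp only [hΦ, add_sub_cancel_right]
    rw [show x + δ + δ + δ = x + 3 * δ by ring, show x + δ + δ = x + 2 * δ by ring]
    ring
  rw [hre] at h
  refine h.trans (le_of_eq ?_)
  ring

/-- **Third difference of the CUT profile**: `|ĝ(x+3δ) − 3ĝ(x+2δ) + 3ĝ(x+δ) − ĝ(x)| ≤ 4K₃δ³` (`0 < δ`; `ĝ(y) = ψ(|y|) = ψ(y) + ψ(−y) − 1`). -/
theorem klct_absProfile_thirdDiff_le (x : ℝ) {δ : ℝ} (hδ : 0 < δ) :
    |Real.smoothTransition (4 / 3 - 32 / 3 * |x + 3 * δ|) - 3 * Real.smoothTransition (4 / 3 - 32 / 3 * |x + 2 * δ|) +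
        3 * Real.smoothTransition (4 / 3 - 32 / 3 * |x + δ|) - Real.smoothTransition (4 / 3 - 32 / 3 * |x|)| ≤ 4 * ((32 / 3) ^ 3 * 5391) * δ ^ 3 := by
  simp only [klct_absProfile_eq_sum]
  have h1 := klct_profile_thirdDiff_le x hδ
  -- the reflected stencil: base point `−x − 3δ`
  have h2 := klct_profile_thirdDiff_le (-x - 3 * δ) hδ
  rw [show -x - 3 * δ + 3 * δ = -x by ring, show -x - 3 * δ + 2 * δ = -(x + δ) by ring, show -x - 3 * δ + δ = -(x + 2 * δ) by ring,
    show -x - 3 * δ = -(x + 3 * δ) by ring] at h2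
  have hsplit : Real.smoothTransition (4 / 3 - 32 / 3 * (x + 3 * δ)) + Real.smoothTransition (4 / 3 - 32 / 3 * -(x + 3 * δ)) - 1 -
        3 * (Real.smoothTransition (4 / 3 - 32 / 3 * (x + 2 * δ)) + Real.smoothTransition (4 / 3 - 32 / 3 * -(x + 2 * δ)) - 1) +
        3 * (Real.smoothTransition (4 / 3 - 32 / 3 * (x + δ)) + Real.smoothTransition (4 / 3 - 32 / 3 * -(x + δ)) - 1) -
        (Real.smoothTransition (4 / 3 - 32 / 3 * x) + Real.smoothTransition (4 / 3 - 32 / 3 * -x) - 1) =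
      (Real.smoothTransition (4 / 3 - 32 / 3 * (x + 3 * δ)) - 3 * Real.smoothTransition (4 / 3 - 32 / 3 * (x + 2 * δ)) +
        3 * Real.smoothTransition (4 / 3 - 32 / 3 * (x + δ)) - Real.smoothTransition (4 / 3 - 32 / 3 * x)) -
      (Real.smoothTransition (4 / 3 - 32 / 3 * -x) - 3 * Real.smoothTransition (4 / 3 - 32 / 3 * -(x + δ)) +
        3 * Real.smoothTransition (4 / 3 - 32 / 3 * -(x + 2 * δ)) - Real.smoothTransition (4 / 3 - 32 / 3 * -(x + 3 * δ))) := by ring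
  rw [hsplit]
  refine (abs_sub _ _).trans ?_
  linarith

/-! ## §5 Third-order cyclic summation by parts -/

variable {N : ℕ} [NeZero N]

/-- **Thrice**: `(z − 1)³·Σ_v f(v) z^v = Σ_v (f(v−1−1−1) − 3f(v−1−1) + 3f(v−1) − f(v)) z^v` for `z^N = 1`. -/
theorem klct_cyclic_sbp_three (f : Fin N → ℂ) (z : ℂ) (hz : z ^ N = 1) :
    (z - 1) ^ 3 * ∑ v : Fin N, f v * z ^ (v : ℕ) = ∑ v : Fin N, (f (v - 1 - 1 - 1) - 3 * f (v - 1 - 1) + 3 * f (v - 1) - f v) * z ^ (v : ℕ) := by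
  rw [pow_succ, mul_comm ((z - 1) ^ 2), mul_assoc, klct_cyclic_sbp_two f z hz, klct_cyclic_sbp (fun v => f (v - 1 - 1) - 2 * f (v - 1) + f v) z hz]
  exact Finset.sum_congr rfl (fun v _ => by ring)

/-- **The third-difference bound**: `|z − 1|³·|Σ_v f(v) z^v| ≤ Σ_v |f(v−3) − 3f(v−2) + 3f(v−1) − f(v)|` for `z^N = 1`. -/
theorem klct_normCube_mul_norm_sum_le_thirdDiff (f : Fin N → ℂ) (z : ℂ) (hz : z ^ N = 1) :
    ‖z - 1‖ ^ 3 * ‖∑ v : Fin N, f v * z ^ (v : ℕ)‖ ≤ ∑ v : Fin N, ‖f (v - 1 - 1 - 1) - 3 * f (v - 1 - 1) + 3 * f (v - 1) - f v‖ := by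
  have hz1 : ‖z‖ = 1 := klct_norm_eq_one_of_pow_eq_one (NeZero.ne N) hz
  rw [← norm_pow, ← norm_mul, klct_cyclic_sbp_three f z hz]
  refine (norm_sum_le _ _).trans (le_of_eq (Finset.sum_congr rfl (fun v _ => ?_)))
  rw [norm_mul, norm_pow, hz1, one_pow, mul_one]

/-! ## §6 Pointwise quadratic decay of the cut leg transform -/

variable {M : ℕ} [NeZero M]

/-- **POINTWISE DECAY OF THE CUT LEG TRANSFORM** (`128 ≤ β ≤ M`): for every `j ∈ ℤ_{2M}`,
`|Σ_v ĝ(ω_v) e^{−2πivj/(2M)}| · (4·min(j, 2M−j)/(2M))² ≤ C₂(β) = 2K(2π/β)²(3β/(32π) + 6)`, i.e. `|ĉ(j)| ≤ C₂(β)·M²/(4·dist(j)²)`. -/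
theorem klct_legTransform_uvCut_sq_decay {β : ℝ} (hβ : 128 ≤ β) (hM : β ≤ M) (j : ImagTimeIdx M) :
    ‖∑ n : MatsubaraIdx M, (((gnScaleCutoff 4 klE0 1 |matsubaraFreq β M n| : ℝ) : ℂ)) *
        Complex.exp (-((2 * Real.pi * ((n : ℕ) : ℝ) * ((j : ℕ) : ℝ) / (2 * M) : ℝ) : ℂ) * Complex.I)‖ *
      (4 * min ((j : ℕ) : ℝ) (((2 * M : ℕ) : ℝ) - (j : ℕ)) / ((2 * M : ℕ) : ℝ)) ^ 2 ≤
      2 * (11264 / 9) * (2 * Real.pi / β) ^ 2 * (3 * β / (32 * Real.pi) + 6) := by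
  have hMne := NeZero.ne M
  have hN : 0 < 2 * M := by omega
  have hcast : (2 * (M : ℝ)) = ((2 * M : ℕ) : ℝ) := by push_cast; ring
  set z : ℂ := Complex.exp (-((2 * Real.pi * ((j : ℕ) : ℝ) / ((2 * M : ℕ) : ℝ) : ℝ) : ℂ) * Complex.I) with hz
  have hzN : z ^ (2 * M) = 1 := klct_rootOfUnity_pow (N := 2 * M) (j : ℕ)
  have hphase : ∀ n : MatsubaraIdx M,
      Complex.exp (-((2 * Real.pi * ((n : ℕ) : ℝ) * ((j : ℕ) : ℝ) / (2 * M) : ℝ) : ℂ) * Complex.I) = z ^ (n : ℕ) := by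
    intro n; rw [hcast]; exact klct_legPhase_eq_pow (N := 2 * M) (n : ℕ) (j : ℕ)
  simp_rw [hphase]
  have hgap := klct_rootOfUnity_gap (N := 2 * M) hN j.isLt
  have hsbp := klct_normSq_mul_norm_sum_le_secondDiff (fun n : MatsubaraIdx M => (((gnScaleCutoff 4 klE0 1 |matsubaraFreq β M n| : ℝ) : ℂ))) z hzN
  have hC := klct_secondDiffSum_uvCut_le hβ hM
  have h0 : 0 ≤ ‖∑ n : MatsubaraIdx M, (((gnScaleCutoff 4 klE0 1 |matsubaraFreq β M n| : ℝ) : ℂ)) * z ^ (n : ℕ)‖ := norm_nonneg _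
  have hmin0 : 0 ≤ 4 * min ((j : ℕ) : ℝ) (((2 * M : ℕ) : ℝ) - (j : ℕ)) / ((2 * M : ℕ) : ℝ) := by
    apply div_nonneg _ (by positivity)
    apply mul_nonneg (by norm_num)
    apply le_min (by positivity)
    have : ((j : ℕ) : ℝ) < ((2 * M : ℕ) : ℝ) := by exact_mod_cast j.isLt
    linarith
  calc _ ≤ ‖∑ n : MatsubaraIdx M, (((gnScaleCutoff 4 klE0 1 |matsubaraFreq β M n| : ℝ) : ℂ)) * z ^ (n : ℕ)‖ * ‖z - 1‖ ^ 2 := by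
        apply mul_le_mul_of_nonneg_left _ h0
        exact pow_le_pow_left₀ hmin0 hgap 2
    _ ≤ _ := by rw [mul_comm]; exact hsbp.trans hC

end Summit.HubbardSuperconductivity.HubbardSuperconductivity.Theorems.KLRegimeSplit

end
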